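import Literature.NumberTheory.DiophantineGeometry.GeneralizedFermatTwoPowerCoefficientLevelLoweringProofs
import Literature.NumberTheory.EllipticCurves.RationalTwoTorsionSemistableModPIrreduciblePerPrimeProofs
import HarnessLib

/-!
# Ribet 1997, Theorem 3 with the Mazur input PRIME BY PRIME: only `X₁(14)`, Mazur–Tate's `13`
# and Mazur's Step 3 (proofs)

Topic `Literature/NumberTheory/DiophantineGeometry`; a further sibling *proofs* file (theorems
only: no definition, no named fact, no `sorry`) of `GeneralizedFermatTwoPowerCoefficient` (named
fact `ribet1997_twoPowerFermat`: K. Ribet, *On the equation `aᵖ + 2^α bᵖ + cᵖ = 0`*, Acta Arith.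
79 (1997) 7–16, Thm. 3), refining `…MazurTorsionProofs`, `…MazurLeavesProofs` and
`…LevelLoweringProofs`.

There, Ribet's Proposition 1 ("`E[p]` is irreducible for the Frey curves, `p ≥ 5`") took Mazur's
torsion theorem in full (`∀ V, mazur_torsion V`, Mazur 1977, Thm. 8), and hence, through
`forall_mazur_torsion_of_leaves`, the three undischarged leaves `Mazur1977_stepThree_eisenstein`,
`MazurTate1973_no_torsion_thirteen` and **`Mazur1977_reduction_to_primes`** (Kubert's reduction of
the composite orders `14, 15, 16, 18, 20, 21, 24, 25, 27, 35, 49` to primes).  But the printed proof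
(Ribet, p. 11: "some elliptic curve over `ℚ` which is isogenous to `E` contains a group of rational
points which is isomorphic to `ℤ/2ℤ ⊕ ℤ/2lℤ`") uses the classification only for the one prime
`l = p`, as "no `E/ℚ` has rational `P₁ ≠ P₂` of order `2` and `Q` of order `p`" — the statement
`(⋆ₚ)` of `RationalTwoTorsionSemistableModPIrreduciblePerPrimeProofs`, which that file derives
prime by prime: `p = 5` from Kubert's `X₁(2,10)` (a theorem of the tree), `p = 7` from
"no rational point of order `14`" (`X₁(14)`; hypothesis `h14` here, a theorem of the tree by
`KubertTateFourteen` with `X1FourteenMordellWeil`), `p = 11` from Billing–Mahler (a theorem of the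
tree), `p = 13` from Mazur–Tate, `p ≥ 17` from Mazur's Step 3.  Consequently Ribet's Theorem 3
rests, of Mazur's theorem, on `Mazur1977_stepThree_eisenstein` and
`MazurTate1973_no_torsion_thirteen` only (given `h14`): **`Mazur1977_reduction_to_primes` drops out
of the cone of `ribet1997_twoPowerFermat`.**

## Main statements

* `hasIrreducibleModPGaloisRep_freyCurve_of_noTwoTorsionPrime` — Prop. 1 (with its Corollary) for
  the normalised Frey curves and ONE prime `p ≥ 5`, from `(⋆ₚ)`; the additive case (`16 ∤ B`) is
  Diamond–Kramer's parity argument exactly as in `hasIrreducibleModPGaloisRep_freyCurve_of_mazur_torsion`.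
* `hasIrreducibleModPGaloisRep_freyCurve_of_mazur_prime_leaves` — all `p ≥ 5`, from `h14`, `h13`,
  `hE`.
* `ribet1997_twoPowerFermat_of_khare_wintenberger_of_mazur_prime_leaves` — Theorem 3 ⟸
  `khare_wintenberger` + `h14` + `MazurTate1973_no_torsion_thirteen` + `Mazur1977_stepThree_eisenstein`.
* `ribet1997_twoPowerFermat_of_modularity_of_levelLowering_of_mazur_prime_leaves` — Theorem 3 along
  the printed road ⟸ `exists_isNewformOf` (Thm. 5) + level-lowering `hLL` ([18], Diamond 1995
  Thm. 1.1) + the same three torsion inputs.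

## References

* [Ribet1997] K. A. Ribet, Acta Arith. 79 (1997) 7–16: Thm. 3, Thm. 5, Prop. 1 (p. 11–12), §3.
* [Mazur1977] B. Mazur, Publ. Math. IHÉS 47 (1977): Thm. 8; Ch. III §5, p. 156 (First reduction)
  and Step 3 (p. 159).
* [MazurTate1973] B. Mazur, J. Tate, Invent. Math. 22 (1973) 41–49.
* [Kubert1976] D. S. Kubert, Proc. London Math. Soc. (3) 33 (1976) 193–237, Ch. IV.
* [KhareWintenberger2009] Invent. Math. 178 (2009), Thm. 1.2; [Diamond1995RefinedSerre] Thm. 1.1;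
  [BCDTJAMS2001] Theorem A; [DiamondKramer1995] Lemma 3.
-/

noncomputable section

open scoped MatrixGroups ModularForm NumberField
open CongruenceSubgroup UpperHalfPlane Polynomial

namespace Literature.NumberTheory.DiophantineGeometry

open WeierstrassCurve GaloisRepresentations EllipticCurves EllipticCurves.ModularForms
  Rat.HeightOneSpectrum IsDedekindDomain IsDedekindDomain.HeightOneSpectrum
  Literature.NumberTheory.Automorphic Literature.NumberTheory.Automorphic.BCDT

/-! ## Part A. Ribet's Proposition 1 for the Frey curves, one prime at a time -/

section PropositionOne

variable {A B : ℤ}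

/-- **Ribet 1997, Proposition 1 (with its Corollary) for the normalised Frey curves and ONE prime
`p ≥ 5`, from `(⋆ₚ)`.**  Let `A ≡ −1 (mod 4)`, `4 ∣ B`, `A, B` coprime, `AB(A+B) ≠ 0`, `p ≥ 5`
prime, and suppose no elliptic curve over `ℚ` has rational points `P₁ ≠ P₂` of order `2` and `Q` of
order `p` (`hNo`).  Then `E[p]` is irreducible for `E : y² = x(x − A)(x + B)`: if `16 ∣ B`, `E` is
semistable with rational `2`-torsion and
`hasIrreducibleModPGaloisRep_of_isSemistable_of_rational_two_torsion_of_noTwoTorsionPrime` applies;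
if `16 ∤ B`, `Sw_𝔓(E[p]) = 1` at a prime above `2` and Diamond–Kramer's parity lemma
`hasIrreducibleModPGaloisRep_of_swanConductorAt_torsion_eq_one` applies (verbatim the additive
branch of `hasIrreducibleModPGaloisRep_freyCurve_of_mazur_torsion`).
[cite: Ribet1997, Prop. 1 and Corollary (p. 11–12)] [cite: DiamondKramer1995, Lemma 3] -/
theorem hasIrreducibleModPGaloisRep_freyCurve_of_noTwoTorsionPrime {p : ℕ}
    (hNo : ∀ (V : WeierstrassCurve ℚ) [V.IsElliptic] (P₁ P₂ Q : V.toAffine.Point),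
      addOrderOf P₁ = 2 → addOrderOf P₂ = 2 → P₁ ≠ P₂ → addOrderOf Q = p → False)
    (hAB : IsCoprime A B) (h0 : A * B * (A + B) ≠ 0) (hA : A ≡ -1 [ZMOD 4]) (h4 : (4 : ℤ) ∣ B)
    (hp : p.Prime) (h5 : 5 ≤ p) : (freyCurve A B).HasIrreducibleModPGaloisRep p := by
  haveI := isElliptic_freyCurve h0
  haveI : Fact p.Prime := ⟨hp⟩
  by_cases h16 : (16 : ℤ) ∣ B
  · -- semistable: `(⋆ₚ)`
    exact hasIrreducibleModPGaloisRep_of_isSemistable_of_rational_two_torsion_of_noTwoTorsionPrime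
      hNo (freyCurve A B) (isSemistable_freyCurve_of_sixteen_dvd hAB h0 hA h16)
      (fun σ P hP ↦ smul_eq_of_two_nsmul_eq_zero_freyCurve h0 σ hP) hp h5
  · -- additive at `2`: Diamond–Kramer's parity argument
    have hp2 : p ≠ 2 := by omega
    obtain ⟨𝔓, h𝔓, hSw⟩ :=
      swanConductorAt_torsion_freyCurve_eq_one_of_sixteen_not_dvd h0 hA h4 h16 p hp2
    set v : HeightOneSpectrum (𝓞 ℚ) := (primesEquiv (R := 𝓞 ℚ)).symm ⟨2, Nat.prime_two⟩ with hv
    have hv2 : (2 : 𝓞 ℚ) ∈ v.asIdeal := by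
      have := (natCast_mem_asIdeal_iff_primesEquiv_eq v Nat.prime_two).mpr
        (by rw [hv, Equiv.apply_symm_apply])
      exact_mod_cast this
    have hpv : ((p : ℕ) : 𝓞 ℚ) ∉ v.asIdeal :=
      natCast_not_mem_asIdeal_of_odd hv2 (hp.odd_of_ne_two hp2)
    exact hasIrreducibleModPGaloisRep_of_swanConductorAt_torsion_eq_one (freyCurve A B) p hpv h𝔓 hSw

/-- **Ribet 1997, Proposition 1 for the normalised Frey curves, all primes `p ≥ 5`, from the three
torsion leaves**: no rational point of order `14` (`h14`; `X₁(14)`, Kubert 1976 Ch. IV), Mazur–Tate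
1973 (`h13`) and Mazur's Step 3 (`hE`, used only for `p ≥ 17`); `p = 5` (Kubert's `X₁(2,10)`) and
`p = 11` (Billing–Mahler) being theorems of the tree (`noTwoTorsionPrime_of_leaves`).
[cite: Ribet1997, Prop. 1 and Corollary (p. 11–12)] [cite: Mazur1977, Thm 8 and Ch. III §5 p. 156] -/
theorem hasIrreducibleModPGaloisRep_freyCurve_of_mazur_prime_leaves
    (h14 : ∀ (V : WeierstrassCurve ℚ) [V.IsElliptic], ¬ ∃ P : V.toAffine.Point, addOrderOf P = 14)
    (h13 : ∀ V : WeierstrassCurve ℚ, MazurTate1973_no_torsion_thirteen V)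
    (hE : Mazur1977_stepThree_eisenstein)
    (hAB : IsCoprime A B) (h0 : A * B * (A + B) ≠ 0) (hA : A ≡ -1 [ZMOD 4]) (h4 : (4 : ℤ) ∣ B)
    {p : ℕ} (hp : p.Prime) (h5 : 5 ≤ p) : (freyCurve A B).HasIrreducibleModPGaloisRep p :=
  hasIrreducibleModPGaloisRep_freyCurve_of_noTwoTorsionPrime
    (fun V _ _ _ _ hP₁ hP₂ h12 hQ ↦ noTwoTorsionPrime_of_leaves h14 h13 hE hp h5 V hP₁ hP₂ h12 hQ)
    hAB h0 hA h4 hp h5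

end PropositionOne

/-! ## Part B. Theorem 3 with the Mazur input prime by prime (both roads) -/

section Assembly

open ValuativeRel GaloisRepresentations.ModPGaloisRep GaloisRepresentations.IsNonarchimedeanLocalField

/-- **Ribet 1997, Theorem 3, from `khare_wintenberger` and the three torsion leaves `h14`
(`X₁(14)`), `MazurTate1973_no_torsion_thirteen`, `Mazur1977_stepThree_eisenstein`.**  For a prime
`p ≥ 5` and `2 ≤ α < p`, `xᵖ + 2^α yᵖ + zᵖ = 0` has no solution in pairwise coprime non-zero
integers.  The assembly `ribet1997_twoPowerFermat_of_khare_wintenberger_of_freyOggSaito_canonical'`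
with `hirr` by `hasIrreducibleModPGaloisRep_freyCurve_of_mazur_prime_leaves` and the other
Frey-curve inputs discharged exactly as in
`ribet1997_twoPowerFermat_of_khare_wintenberger_of_mazur_torsion`.  Compared with
`ribet1997_twoPowerFermat_of_khare_wintenberger_of_mazur_leaves`, Kubert's reduction
`Mazur1977_reduction_to_primes` is replaced by the single case `X₁(14)` (`h14`).
[cite: Ribet1997, Thm. 3, Prop. 1, §§2–3] [cite: KhareWintenberger2009, Thm. 1.2]
[cite: Mazur1977, Ch. III §5, Step 3 (p. 159)] [cite: MazurTate1973, main theorem]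
[cite: Kubert1976, Ch. IV (X₁(14))] -/
theorem ribet1997_twoPowerFermat_of_khare_wintenberger_of_mazur_prime_leaves
    (hKW : ∀ (p : ℕ) [Fact p.Prime] (k : Type) [Field k] [TopologicalSpace k] [DiscreteTopology k],
      khare_wintenberger p k)
    (h14 : ∀ (V : WeierstrassCurve ℚ) [V.IsElliptic], ¬ ∃ P : V.toAffine.Point, addOrderOf P = 14)
    (h13 : ∀ V : WeierstrassCurve ℚ, MazurTate1973_no_torsion_thirteen V)
    (hE : Mazur1977_stepThree_eisenstein) : ribet1997_twoPowerFermat := by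
  refine ribet1997_twoPowerFermat_of_khare_wintenberger_of_freyOggSaito_canonical'
    hKW (fun _ _ _ hp h5 hcop h0 hA h4 ↦
      hasIrreducibleModPGaloisRep_freyCurve_of_mazur_prime_leaves h14 h13 hE hcop h0 hA h4 hp h5)
    (fun A B p _ _ hcop h0 hA h4 ↦
      artinConductorExponent_tate_eq_conductorExponent_freyCurve_of_freySwan
        (fun _ _ _ h0 hA h4 h16 ↦
          exists_swanConductorAt_torsion_three_freyCurve_of_sixteen_not_dvd h0 hA h4 h16)
        hcop h0 hA h4 p)
    ?_ conductorExponent_freyCurve_two_le_three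
  intro W _ p _ ρ hρ k _ _ _ _ _ j v hvp hsemi hord
  rcases hsemi with hgood | hmult
  · exact not_dvd_serreLevel_baseChange_of_hasGoodReductionAt_int W p hρ j _ v hvp hgood
  · exact not_dvd_serreLevel_baseChange_of_hasMultiplicativeReductionAt_of_dvd_int W p hρ j _ v hvp
      hmult hord

/-- **Ribet 1997, Theorem 3 along the PRINTED road, from Theorem 5 (`exists_isNewformOf`),
level-lowering "[18]" (Diamond 1995 Thm. 1.1, hypothesis `hLL`) and the three torsion leaves `h14`
(`X₁(14)`), `MazurTate1973_no_torsion_thirteen`, `Mazur1977_stepThree_eisenstein`** — the finest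
statement of what Theorem 3 rests on in the tree along Ribet's own road.  The assembly
`ribet1997_twoPowerFermat_of_modularity_of_levelLowering_canonical` with `hirr` by
`hasIrreducibleModPGaloisRep_freyCurve_of_mazur_prime_leaves`, the other inputs as in
`ribet1997_twoPowerFermat_of_modularity_of_levelLowering_of_mazur_torsion`.
[cite: Ribet1997, Thm. 3, Thm. 5, Prop. 1, §3 p. 13] [cite: Ribet1990, Thm. 1.1]
[cite: Diamond1995RefinedSerre, Thm. 1.1] [cite: BCDTJAMS2001, Theorem A]
[cite: Mazur1977, Ch. III §5, Step 3 (p. 159)] [cite: MazurTate1973, main theorem]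
[cite: Kubert1976, Ch. IV (X₁(14))] -/
theorem ribet1997_twoPowerFermat_of_modularity_of_levelLowering_of_mazur_prime_leaves
    (hmod : exists_isNewformOf)
    (hLL : ∀ (ℓ : ℕ) [Fact ℓ.Prime], Odd ℓ →
      ∀ (k : Type) [Field k] [TopologicalSpace k] [DiscreteTopology k] [CharP k ℓ] [IsAlgClosed k]
        (ρ : ModPGaloisRep ℚ k 2), ρ.toGaloisRep.IsIrreducible → FramedGaloisRep.IsOdd ρ →
        ρ.IsModular →
        ∀ (loc : LocalRestrictionAt ℓ ρ)
          (ι : absIntegers 𝒪[loc.F] loc.F ⧸ absMaximalIdeal loc.F →+* k),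
          ∃ (M : ℕ) (_ : NeZero M), M ∣ serreLevel ℓ ρ ∧
            ∃ (f : CuspForm (Gamma1 M) (serreWeight ℓ ρ loc ι : ℤ))
              (ιf : coeffCharIntegers f →+* k),
              IsNewform1 f ∧ IsGaloisRepOfNewform1Int f ιf {q | q ∣ M * ℓ} ρ)
    (h14 : ∀ (V : WeierstrassCurve ℚ) [V.IsElliptic], ¬ ∃ P : V.toAffine.Point, addOrderOf P = 14)
    (h13 : ∀ V : WeierstrassCurve ℚ, MazurTate1973_no_torsion_thirteen V)
    (hE : Mazur1977_stepThree_eisenstein) : ribet1997_twoPowerFermat := by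
  refine ribet1997_twoPowerFermat_of_modularity_of_levelLowering_canonical hmod hLL
    (fun _ _ _ hp h5 hcop h0 hA h4 ↦
      hasIrreducibleModPGaloisRep_freyCurve_of_mazur_prime_leaves h14 h13 hE hcop h0 hA h4 hp h5)
    (fun A B p _ _ hcop h0 hA h4 ↦
      artinConductorExponent_tate_eq_conductorExponent_freyCurve_of_freySwan
        (fun _ _ _ h0 hA h4 h16 ↦
          exists_swanConductorAt_torsion_three_freyCurve_of_sixteen_not_dvd h0 hA h4 h16)
        hcop h0 hA h4 p)
    ?_ conductorExponent_freyCurve_two_le_three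
  intro W _ p _ ρ hρ k _ _ _ _ _ j v hvp hsemi hord
  rcases hsemi with hgood | hmult
  · exact not_dvd_serreLevel_baseChange_of_hasGoodReductionAt_int W p hρ j _ v hvp hgood
  · exact not_dvd_serreLevel_baseChange_of_hasMultiplicativeReductionAt_of_dvd_int W p hρ j _ v hvp
      hmult hord

/-- **Consistency with the `mazur_torsion` road**: the full classification implies each `(⋆ₚ)`
(`false_of_mazur_torsion`), so `hasIrreducibleModPGaloisRep_freyCurve_of_noTwoTorsionPrime`
recovers `hasIrreducibleModPGaloisRep_freyCurve_of_mazur_torsion`.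
[cite: Ribet1997, Prop. 1 (p. 11–12)] [cite: Mazur1977, Thm 8] -/
theorem hasIrreducibleModPGaloisRep_freyCurve_of_noTwoTorsionPrime_of_mazur_torsion {A B : ℤ}
    (hMT : ∀ V : WeierstrassCurve ℚ, mazur_torsion V) (hAB : IsCoprime A B)
    (h0 : A * B * (A + B) ≠ 0) (hA : A ≡ -1 [ZMOD 4]) (h4 : (4 : ℤ) ∣ B) {p : ℕ} (hp : p.Prime)
    (h5 : 5 ≤ p) : (freyCurve A B).HasIrreducibleModPGaloisRep p :=
  hasIrreducibleModPGaloisRep_freyCurve_of_noTwoTorsionPrime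
    (fun V _ _ _ _ hP₁ hP₂ h12 hQ ↦ false_of_mazur_torsion V (hMT V) hp h5 hP₁ hP₂ h12 hQ)
    hAB h0 hA h4 hp h5

end Assembly

end Literature.NumberTheory.DiophantineGeometry

end
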